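import Literature.MathematicalPhysics.QuantumFieldTheory.Balaban1983to89.B13NodeTorusConsts
import Literature.MathematicalPhysics.QuantumFieldTheory.Balaban1983to89.B13Lemma3TorusBinders

/-!
# `Balaban1983to89.B13ChainJointNonvacuity` — T. Bałaban, *Renormalization group approach to lattice gauge field
theories. II. Cluster expansions*, Commun. Math. Phys. **116** (1988) 1–22, doi:10.1007/bf01239022 [Balaban1988RG2Cluster]:
A JOINT NON-VACUITY WITNESS FOR THE NUMERICAL HYPOTHESES OF THE N10 TORUS CHAIN **THROUGH (2.19)**, with the printed
restriction R12 p. 16 *"We assume that ⅛(κ₁ − 1) ≧ (1 − 3δ)κ, C₃ ≦ E₀C₁, and q ≧ 8"* HONOURED (`q = 8`): one constants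
record meeting at once (A) the numbers of the Lemma 2 → Lemma 3 bridge (`B13Ineq220Torus` / `B13Lemma3TorusBinders`
§3–§5: R12, κ₁ ≥ 1 + 4 log 162, δκ ≥ 64 log 162, M ≥ 1, E₀, ε₁, C₁, α₄ > 0, C₃ ≥ 0, the T7 floor of
`B13Lemma2TorusT7`, κ₁ ≥ 11/3), (B) the 16 Lemma-1 ∕ leaf thresholds of `B13NodeTorusConsts.consts_meets_lemma1_thresholds`,
and (C) the 41 Lemma-3 conjuncts of `B13Lemma3TorusNonvacuity.numerics_nonvacuous_pos` (restrictions R15–R18, R20,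
R22–R24, the (2.29)/(2.31) smallness, the O(1) of (2.37)/(2.38)/(2.41), the ½E₀ bookkeeping, the (2.18) contour radii)

statement-level skeleton of published theorems with citation tags; proofs where landed; nothing here is a claim about
the Yang–Mills mass gap

CITATION HEADER (verbatim).  p. 16 [PDF 16]: *"We assume that ⅛(κ₁ − 1) ≧ (1 − 3δ)κ, C₃ ≦ E₀C₁, and q ≧ 8."*
(typed `B13Bound143.R12`); p. 21 [PDF 21]: *"The assumptions allow finally us to fix all the constants, or rather bounds
on these constants."*; p. 9 [PDF 9], Lemma 1: *"There exist absolute constants C₁, C₂, q, for which (1.36) …"*.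

WHY THIS FILE (cell `pub-ymgap`, HUMAN RULING D-0062 Track A, node N10 = [B13], seat `pub-ymgap-dag-n10-b`, on the
planner's word [DAGLEAD-G0-REBALANCE-20-N10B-JOINT-WITNESS]).  The three witnesses in the tree —
`B13Lemma3WindowNonvacuity.consts`, `B13Lemma3TorusNonvacuity.consts`, `B13Lemma1BlocksTorusNonvacuity` — set `q := 0`:
correct for THEIR theorems (no R12 among their hypotheses), but the Lemma 2 → Lemma 3 bridge (2.18)–(2.20) derives (2.19)
from (1.43) by `B13Bound143.elem219_of_bound143`, whose hypothesis R12 requires `q ≥ 8` (the `M⁴` of (1.43) against the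
`M^q` of (2.18), p. 16).  THIS FILE exhibits the record
`c₈ := {B13Lemma3TorusNonvacuity.consts with q := 8, C₂ := 50, ε₁ := ε₁t·M⁻⁸·e^{−49κ₁}}` — the printed order of choices
(*"ε₁ sufficiently small"* last): the products `ε₁·M^q·e^{C₂κ₁}` through which ε₁ enters EVERY Lemma-3 restriction
(`eps2`, `C3act·ε₁`, `invTau`) are UNCHANGED (`eps2_c8`, `C3actε_c8`, `invTau_c8`), so the 41 conjuncts of the torus
witness transfer VERBATIM, while `q = 8` and `C₂ = 50` serve R12 and the floor `27C₁³e^{49κ₁−1} ≤ C₃e^{C₂κ₁}` of the T7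
producer; the Lemma-1 thresholds are ε₁-free but for `0 < E₀ε₁C₁M^q e^{C₂κ₁}`, `0 ≤ ε₁`.  ONE theorem:
**`chain_joint_nonvacuous`** (∃ c, 12 + 16 + 41 conjuncts).  What it certifies: the numerical hypotheses of
`B13NodeTorus.b13_main_twoTorus_located(_of_226)` (Lemma-1 leg), `B13Lemma2Torus*` (numbers), `B13Ineq220Torus` /
`B13Lemma3TorusBinders` §3–§5 (numbers incl. R12) and `B13Lemma3Torus.bound238_torus` /
`B13Lemma3TorusTerms.deliverables_torus_termwise_of_226` (the 41) are JOINTLY consistent AS TYPED — nothing about the size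
of Bałaban's constants, nothing about the object-dependent smallness of the (2.26) capstone (`hαc`, `hsmall`, `hvol`:
kernel data θ, K₀, c, g of NODE O).
HONEST SCOPE.  Consistency of typed inequalities only; count-neutral; NOT a node discharge; nothing continuum ∕ OS ∕
mass-gap ∕ Clay.  No `sorry`, no definition (the record is the `∃`-witness inside the proof), no new named fact (D-0026).
-/

noncomputable section

namespace Literature.MathematicalPhysics.QuantumFieldTheory.Balaban1983to89.B13ChainJointNonvacuity

open Literature.MathematicalPhysics.QuantumFieldTheory.Balaban1983to89
open Literature.MathematicalPhysics.QuantumFieldTheory.Balaban1983to89.B12TreeDecay (kappa₀ K₀ K₀_pos kappa₀_nonneg)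
open Literature.MathematicalPhysics.QuantumFieldTheory.Balaban1983to89.B13Bound143 (invTau R12)
open Literature.MathematicalPhysics.QuantumFieldTheory.Balaban1983to89.B13Lemma3WindowNonvacuity
  (Kw κ₀w κw δw μw α₆w Aup A₁w A₂w ε₂w aw)
open Literature.MathematicalPhysics.QuantumFieldTheory.Balaban1983to89.B13Lemma3TorusNonvacuity
  (κ₁t ε₁t consts numerics_nonvacuous_pos_consts)
open Literature.MathematicalPhysics.QuantumFieldTheory.Balaban1983to89.B13NodeTorusConsts (consts_meets_lemma1_thresholds)

/-- **JOINT NON-VACUITY OF THE N10 TORUS CHAIN THROUGH (2.19), `q = 8`.**  There is ONE constants record `c` (namely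
`B13Lemma3TorusNonvacuity.consts` with `q := 8`, `C₂ := 50`, `ε₁ := ε₁t·M⁻⁸·e^{−49κ₁}`; L = 8, δ = 3/40) satisfying
SIMULTANEOUSLY: (A) the numbers of the Lemma 2 → Lemma 3 bridge and of the Lemma-2 producers — `q = 8`, R12
(`B13Bound143.R12`: ⅛(κ₁ − 1) ≥ (1 − 3δ)κ, C₃ ≤ E₀C₁, q ≥ 8), κ₁ ≥ 11/3, κ₁ ≥ 1 + 4 log 162, δκ ≥ 64 log 162, M ≥ 1,
E₀, ε₁, C₁, α₄ > 0, C₃ ≥ 0, and the floor `27C₁³e^{49κ₁−1} ≤ C₃e^{C₂κ₁}` of `B13Lemma2TorusT7.bound143_twoTorus_T7` (at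
C₃′ = 1); (B) the 16 Lemma-1 ∕ leaf thresholds of `B13NodeTorusConsts.consts_meets_lemma1_thresholds` (N′ = 2); (C) the 41
conjuncts of `B13Lemma3TorusNonvacuity.numerics_nonvacuous_pos` (bond-cube side 1, rate `aw`, a₂ = a₂′ = 1, a₅ = ½,
Aabs = 1, Bc = 1/64) VERBATIM.  p. 21: *"The assumptions allow finally us to fix all the constants"*; p. 16: *"q ≧ 8"*.
[cite: Balaban1988RG2Cluster, p.16 (after (2.18)) and p.21 (closing paragraph)] -/
theorem chain_joint_nonvacuous : ∃ c : B13.Consts,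
    -- (A) the bridge / producer numbers
    (c.q = 8 ∧ R12 c ∧ 11 / 3 ≤ c.κ₁ ∧ 1 + 4 * Real.log 162 ≤ c.κ₁ ∧ 64 * Real.log 162 ≤ c.δ * c.κ ∧ 1 ≤ c.M ∧
      0 < c.E₀ ∧ 0 < c.ε₁ ∧ 0 < c.C₁ ∧ 0 < c.α₄ ∧ 0 ≤ c.C₃ ∧
      27 * 1 * c.C₁ ^ 3 * Real.exp (49 * c.κ₁ - 1) ≤ c.C₃ * Real.exp (c.C₂ * c.κ₁)) ∧
    -- (B) the Lemma-1 / leaf thresholds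
    (c.L = 8 ∧ 12 ≤ c.L * 2 ∧ kappa₀ 64 8 ≤ c.κ ∧ kappa₀ 64 8 ≤ c.δ * c.κ ∧ 0 ≤ c.κ ∧
      c.δ < 1 ∧ 1 ≤ c.δ * c.κ ∧
      1 + 2 * Real.log (8 * 12 ^ 3) ≤ c.κ₁ ∧ 2 + 16 * Real.log 128 ≤ c.κ₁ ∧
      10 * Real.exp (-1) ≤ c.δ₀ * c.M ∧ 2 * Real.log 5 ≤ c.δ₀ * c.M ∧
      (1 - c.δ) * c.κ ≤ (1 / 4) * (c.κ₁ - 1) ∧ (1 - 2 * c.δ) * c.κ ≤ (1 / 16) * c.κ₁ ∧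
      0 < c.E₀ * c.ε₁ * c.C₁ * c.M ^ c.q * Real.exp (c.C₂ * c.κ₁) ∧ 0 ≤ c.ε₁ ∧ 0 ≤ c.C₃) ∧
    -- (C) the 41 Lemma-3 conjuncts
    (8 ≤ c.L ∧ 0 < (1 : ℕ) ∧ 0 < c.ε₁ ∧ 0 < c.α₆ ∧ 0 ≤ c.eps2 ∧ 0 ≤ c.δ ∧
      0 ≤ 1 - 7 * c.δ ∧ 0 ≤ c.κ ∧ 0 ≤ aw ∧
      c.R15 ∧ 18 * ((1 - 4 * c.δ) * c.κ) ≤ aw / 20 ∧ 4 * c.κ ≤ aw / 20 ∧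
      Real.exp (-(aw / 20)) ≤ c.eps2 ∧
      2 * (4 : ℝ) * ((1 : ℕ) : ℝ) ^ 4 * Real.exp (-(aw / 10)) ≤ aw / 20 ∧
      0 ≤ (1 : ℝ) ∧ kappa₀ 64 8 + 1 ≤ c.δ * c.κ ∧ c.α₆ * Real.exp 1 * K₀ 64 8 * 64 ≤ 1 ∧
      Real.exp (-(aw / 20)) * 64 ≤ c.δ * c.κ ∧
      B13Step237.R18half c (K₀ 64 8 * Real.exp (Real.exp (-(aw / 20)) * 64)) ∧
      B13Step237.R18sharp c (K₀ 64 8 * Real.exp (Real.exp (-(aw / 20)) * 64)) ((c.L : ℝ) / 2) ∧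
      0 ≤ (1 : ℝ) ∧ kappa₀ 64 8 + 1 ≤ c.δ * ((c.L : ℝ) / 2) * c.κ ∧
      c.α₆ * Real.exp 1 * K₀ 64 8 * 64 ≤ 1 ∧
      18 * ((1 - 7 * c.δ) * ((c.L : ℝ) / 2) * c.κ) ≤ (c.κ₁ - 1) / 2 ∧
      (0 : ℝ) ≤ 1 / 2 ∧ 1 / 2 + Real.exp (-((c.κ₁ - 1) / 2)) ≤ 1 ∧ 1 * 64 ≤ c.δ * ((c.L : ℝ) / 2) * c.κ ∧
      B13Step237.bracketF c (K₀ 64 8 * Real.exp (Real.exp (-(aw / 20)) * 64)) / c.α₆ * Real.exp (1 * 64) ≤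
        c.C3act * c.ε₁ ∧
      0 ≤ c.C3act * c.ε₁ ∧
      c.κ + 2 * (64 * Real.log 162) + 2 ≤ (1 - 8 * c.δ) * ((c.L : ℝ) / 2) * c.κ ∧
      c.C3act * c.ε₁ * Real.exp (5 * c.κ + 1) * K₀ 64 8 * 9 * 64 ≤ 1 ∧
      Real.exp 1 * 9 * 64 * K₀ 64 8 ^ 2 ≤ c.A₂ ∧ c.R22 ∧ c.R23 ∧ c.R24sharp ∧ 0 ≤ c.E₀ ∧
      0 ≤ (1 / 64 : ℝ) ∧ 1 / 64 * 64 ≤ c.E₀ / 2 ∧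
      (0 : ℝ) < 1 / 2 ∧ 1 ≤ c.κ₁ ∧
      (∀ d : ℝ, 0 ≤ d → 0 < invTau c d ∧ invTau c d ≤ 1 / 2)) := by
  -- the witness
  let c8 : B13.Consts :=
    { L := 8, q := 8, M := κw + 1, κ := κw, κ₁ := κ₁t, δ := δw, δ₀ := 1, E₀ := 2,
      ε₁ := ε₁t * ((κw + 1) ^ 8)⁻¹ * Real.exp (-(49 * κ₁t)), C₁ := 1, C₂ := 50, C₃ := 1, α₀ := 1, α₁ := 1,
      α₄ := 1, α₅ := 1, α₆ := α₆w, γ₂ := 1, γ := 1, A₁ := A₁w, A₂ := A₂w }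
  -- elementary facts about the base witness
  have hκ₀ : κ₀w = 64 * Real.log 162 := by
    have h := TreeLengthCubeSystem.kappa₀_four
    show kappa₀ 64 8 = 64 * Real.log 162
    norm_num at h
    exact h
  have hκ₀nn : 0 ≤ κ₀w := kappa₀_nonneg (by norm_num) 8
  have hκw : κw = 20 * (κ₀w + 64) := rfl
  have hκw1280 : 1280 ≤ κw := by rw [hκw]; linarith
  have hμ : μw = (19 / 10) * κw := by show (1 - 7 * δw) * 4 * κw = _; unfold δw; ring
  have hκ₁t : κ₁t = 1 + 36 * μw := rfl
  have hKw : 0 < Kw := K₀_pos 64 8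
  have hα₆ : 0 < α₆w := by unfold α₆w; positivity
  have hAup : 0 < Aup := by unfold Aup; positivity
  have hA₁ : 0 < A₁w := by unfold A₁w; positivity
  have hA₂ : 0 < A₂w := by unfold A₂w; positivity
  have hε₂ : 0 < ε₂w := by unfold ε₂w; positivity
  have hε₁t : 0 < ε₁t := by unfold ε₁t; positivity
  have hM : (consts.M : ℝ) = κw + 1 := rfl
  have hM0 : 0 < κw + 1 := by linarith
  have hε₁' : 0 < ε₁t * ((κw + 1) ^ 8)⁻¹ * Real.exp (-(49 * κ₁t)) := by positivity
  -- the three invariant products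
  have hkey : ε₁t * ((κw + 1) ^ 8)⁻¹ * Real.exp (-(49 * κ₁t)) * (κw + 1) ^ 8 * Real.exp (50 * κ₁t) =
      ε₁t * (κw + 1) ^ 0 * Real.exp (1 * κ₁t) := by
    have h8 : ((κw + 1) ^ 8)⁻¹ * (κw + 1) ^ 8 = 1 := inv_mul_cancel₀ (by positivity)
    have he : Real.exp (-(49 * κ₁t)) * Real.exp (50 * κ₁t) = Real.exp (1 * κ₁t) := by
      rw [← Real.exp_add]; congr 1; ring
    calc ε₁t * ((κw + 1) ^ 8)⁻¹ * Real.exp (-(49 * κ₁t)) * (κw + 1) ^ 8 * Real.exp (50 * κ₁t)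
        = ε₁t * (((κw + 1) ^ 8)⁻¹ * (κw + 1) ^ 8) * (Real.exp (-(49 * κ₁t)) * Real.exp (50 * κ₁t)) := by ring
      _ = ε₁t * (κw + 1) ^ 0 * Real.exp (1 * κ₁t) := by rw [h8, he]; ring
  have hK₀ε : c8.ε₁ * c8.K₀ = consts.ε₁ * consts.K₀ := by
    show ε₁t * ((κw + 1) ^ 8)⁻¹ * Real.exp (-(49 * κ₁t)) *
        (2 * 1 * (1 : ℝ)⁻¹ * α₆w⁻¹ * (κw + 1) ^ 8 * Real.exp (50 * κ₁t)) =
      ε₁t * (2 * 1 * (1 : ℝ)⁻¹ * α₆w⁻¹ * (κw + 1) ^ 0 * Real.exp (1 * κ₁t))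
    calc ε₁t * ((κw + 1) ^ 8)⁻¹ * Real.exp (-(49 * κ₁t)) *
          (2 * 1 * (1 : ℝ)⁻¹ * α₆w⁻¹ * (κw + 1) ^ 8 * Real.exp (50 * κ₁t))
        = (2 * 1 * (1 : ℝ)⁻¹ * α₆w⁻¹) *
            (ε₁t * ((κw + 1) ^ 8)⁻¹ * Real.exp (-(49 * κ₁t)) * (κw + 1) ^ 8 * Real.exp (50 * κ₁t)) := by ring
      _ = (2 * 1 * (1 : ℝ)⁻¹ * α₆w⁻¹) * (ε₁t * (κw + 1) ^ 0 * Real.exp (1 * κ₁t)) := by rw [hkey]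
      _ = _ := by ring
  have hE : c8.eps2 = consts.eps2 := by
    show c8.E₀ * c8.ε₁ * c8.K₀ = consts.E₀ * consts.ε₁ * consts.K₀
    rw [mul_assoc, hK₀ε, ← mul_assoc]
    rfl
  have hCE : c8.C3act * c8.ε₁ = consts.C3act * consts.ε₁ := by
    show 2 * ((c8.L : ℝ) + 2) ^ 4 * c8.A₁ * (c8.E₀ * c8.K₀) * c8.ε₁ =
      2 * ((consts.L : ℝ) + 2) ^ 4 * consts.A₁ * (consts.E₀ * consts.K₀) * consts.ε₁
    have h1 : 2 * ((c8.L : ℝ) + 2) ^ 4 * c8.A₁ * (c8.E₀ * c8.K₀) * c8.ε₁ =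
        2 * ((c8.L : ℝ) + 2) ^ 4 * c8.A₁ * c8.E₀ * (c8.ε₁ * c8.K₀) := by ring
    rw [h1, hK₀ε]
    show 2 * ((consts.L : ℝ) + 2) ^ 4 * consts.A₁ * consts.E₀ * (consts.ε₁ * consts.K₀) = _
    ring
  have hI : ∀ d : ℝ, invTau c8 d = invTau consts d := by
    intro d
    show c8.E₀ * c8.ε₁ * c8.C₁ * c8.α₄⁻¹ * c8.M ^ c8.q * Real.exp (c8.C₂ * c8.κ₁) *
        Real.exp (-(1 - 3 * c8.δ) * c8.κ * d) =
      consts.E₀ * consts.ε₁ * consts.C₁ * consts.α₄⁻¹ * consts.M ^ consts.q * Real.exp (consts.C₂ * consts.κ₁) *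
        Real.exp (-(1 - 3 * consts.δ) * consts.κ * d)
    show 2 * (ε₁t * ((κw + 1) ^ 8)⁻¹ * Real.exp (-(49 * κ₁t))) * 1 * (1 : ℝ)⁻¹ * (κw + 1) ^ 8 *
        Real.exp (50 * κ₁t) * Real.exp (-(1 - 3 * δw) * κw * d) =
      2 * ε₁t * 1 * (1 : ℝ)⁻¹ * (κw + 1) ^ 0 * Real.exp (1 * κ₁t) * Real.exp (-(1 - 3 * δw) * κw * d)
    calc 2 * (ε₁t * ((κw + 1) ^ 8)⁻¹ * Real.exp (-(49 * κ₁t))) * 1 * (1 : ℝ)⁻¹ * (κw + 1) ^ 8 *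
          Real.exp (50 * κ₁t) * Real.exp (-(1 - 3 * δw) * κw * d)
        = 2 * 1 * (1 : ℝ)⁻¹ * Real.exp (-(1 - 3 * δw) * κw * d) *
            (ε₁t * ((κw + 1) ^ 8)⁻¹ * Real.exp (-(49 * κ₁t)) * (κw + 1) ^ 8 * Real.exp (50 * κ₁t)) := by ring
      _ = 2 * 1 * (1 : ℝ)⁻¹ * Real.exp (-(1 - 3 * δw) * κw * d) * (ε₁t * (κw + 1) ^ 0 * Real.exp (1 * κ₁t)) := by
          rw [hkey]
      _ = _ := by ring
  have hmem : ∀ A : ℝ, B13Step237.memberF c8 A = B13Step237.memberF consts A := by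
    intro A
    show ((c8.L : ℝ) + 2) ^ 4 * A * c8.eps2 = ((consts.L : ℝ) + 2) ^ 4 * A * consts.eps2
    rw [hE]
    rfl
  have hbr : ∀ A : ℝ, B13Step237.bracketF c8 A = B13Step237.bracketF consts A := by
    intro A
    show 2 * B13Step237.memberF c8 A = 2 * B13Step237.memberF consts A
    rw [hmem]
  -- the two source bundles
  obtain ⟨l1, l2, l3, l4, l5, l6, l7, l8, l9, l10, l11, l12, l13, -, -, l16⟩ := consts_meets_lemma1_thresholds
  obtain ⟨n1, n2, -, n4, n5, n6, n7, n8, n9, n10, n11, n12, n13, n14, n15, n16, n17, n18, n19, n20, n21, n22, n23, n24,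
    n25, n26, n27, n28, n29, n30, n31, n32, n33, n34, n35, n36, n37, n38, n39, n40, n41⟩ := numerics_nonvacuous_pos_consts
  refine ⟨c8, ?_, ?_, ?_⟩
  · -- (A)
    have hκ₁ge : 1 + 68 * 1280 ≤ c8.κ₁ := by
      show 1 + 68 * 1280 ≤ κ₁t
      rw [hκ₁t, hμ]; linarith
    have hlog : Real.log 162 ≤ 162 := by
      have := Real.log_le_sub_one_of_pos (show (0 : ℝ) < 162 by norm_num); linarith
    refine ⟨rfl, ?_, ?_, ?_, ?_, ?_, ?_, hε₁', ?_, ?_, ?_, ?_⟩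
    · -- R12
      refine ⟨?_, ?_, ?_⟩
      · show (1 - 3 * δw) * κw ≤ (κ₁t - 1) / 8
        rw [hκ₁t, hμ]; unfold δw; linarith
      · show (1 : ℝ) ≤ 2 * 1; norm_num
      · show 8 ≤ 8; exact le_rfl
    · linarith
    · linarith
    · show 64 * Real.log 162 ≤ δw * κw
      rw [← hκ₀, hκw]; unfold δw; linarith
    · show (1 : ℝ) ≤ κw + 1; linarith
    · show (0 : ℝ) < 2; norm_num
    · show (0 : ℝ) < 1; norm_num
    · show (0 : ℝ) < 1; norm_num
    · show (0 : ℝ) ≤ 1; norm_num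
    · -- the T7 floor at C₃′ = 1: 27·e^{49κ₁−1} ≤ e^{50κ₁}
      show 27 * 1 * (1 : ℝ) ^ 3 * Real.exp (49 * κ₁t - 1) ≤ 1 * Real.exp (50 * κ₁t)
      have h27 : (27 : ℝ) ≤ Real.exp (κ₁t + 1) := by
        have := Real.add_one_le_exp (κ₁t + 1)
        have hk : (26 : ℝ) ≤ κ₁t := by rw [hκ₁t, hμ]; linarith
        linarith
      have hsplit : 1 * Real.exp (50 * κ₁t) = Real.exp (κ₁t + 1) * Real.exp (49 * κ₁t - 1) := by
        rw [one_mul, ← Real.exp_add]; congr 1; ring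
      rw [hsplit]
      have hpos : 0 ≤ Real.exp (49 * κ₁t - 1) := (Real.exp_pos _).le
      calc 27 * 1 * (1 : ℝ) ^ 3 * Real.exp (49 * κ₁t - 1) = 27 * Real.exp (49 * κ₁t - 1) := by ring
        _ ≤ Real.exp (κ₁t + 1) * Real.exp (49 * κ₁t - 1) := mul_le_mul_of_nonneg_right h27 hpos
  · -- (B)
    refine ⟨l1, l2, l3, l4, l5, l6, l7, l8, l9, l10, l11, l12, l13, ?_, hε₁'.le, l16⟩
    show (0 : ℝ) < 2 * (ε₁t * ((κw + 1) ^ 8)⁻¹ * Real.exp (-(49 * κ₁t))) * 1 * (κw + 1) ^ 8 * Real.exp (50 * κ₁t)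
    positivity
  · -- (C): the 41 conjuncts transfer through the invariant products
    refine ⟨n1, n2, hε₁', n4, ?_, n6, n7, n8, n9, ?_, n11, n12, ?_, n14, n15, n16, n17, n18, ?_, ?_, n21, n22, n23,
      n24, n25, n26, n27, ?_, ?_, n30, ?_, n32, n33, ?_, n35, n36, n37, n38, n39, n40, ?_⟩
    · rw [hE]; exact n5
    · show c8.eps2 * Real.exp (5 * c8.κ) ≤ 1
      rw [hE]; exact n10
    · rw [hE]; exact n13
    · show B13Step237.memberF c8 _ ≤ 1 / 2
      rw [hmem]; exact n19
    · show B13Step237.bracketF c8 _ * Real.exp (5 * ((1 - 7 * c8.δ) * _ * c8.κ)) ≤ c8.α₆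
      rw [hbr]; exact n20
    · rw [hbr, hCE]; exact n28
    · rw [hCE]; exact n29
    · rw [hCE]; exact n31
    · show c8.A₂ * c8.C3act * c8.ε₁ ≤ c8.E₀ / 2
      rw [mul_assoc, hCE, ← mul_assoc]; exact n34
    · intro d hd
      rw [hI d]
      exact n41 d hd

end Literature.MathematicalPhysics.QuantumFieldTheory.Balaban1983to89.B13ChainJointNonvacuity

end
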